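import Summits.RiemannHypothesis.RiemannHypothesis.Theorems.SoloInformedQuasiWeil
import Literature.NumberTheory.LFunctions.WeilMarkovQuadratic

/-!
# The pole-free form of Weil's criterion; the Markov spectral-gap form

Solo programme `solo-RiemannHypothesis-informed`, session 14. Everything here is proved (no named
facts, no new hypotheses).

Weil's hermitian form `Q(g) = W(g ⋆ g̃)` (`weilQuadratic`) carries the polar term
`k̂(0) + k̂(1) = 2 Re(ĝ(0) conj ĝ(1))` of `k = g ⋆ g̃`, a form of signature `(1,1)`
(`weilPoleForm`). On the **pole-free** test functions — `ĝ(0) = ĝ(1) = 0`, i.e.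
`g ⊥ e^{t/2}, e^{-t/2}`, a subspace of codimension two in every window, stable under translation
and under the dipoles `g + c·g(· − x)` of Bombieri's proof — the polar term vanishes identically
and `Q(g) = −W_prime(k) + W_arch(k)` refers to the primes and to the archimedean place only.

* `riemannHypothesis_of_stable_class`: Bombieri's converse (Bombieri 2000, Thm. 1, "if") runs
  inside ANY class of test functions stable under the dipoles `g ↦ g + c·g(· − x)` whose members
  detect every non-trivial zero (`P_g(ρ) ≠ 0` for some member): positivity of `Re Q` on the class
  gives the Riemann hypothesis.
* `riemannHypothesis_iff_poleFree`: **`RH ⟺ Re Q(g) ≥ 0` for every pole-free test `g`**;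
  `riemannHypothesis_iff_poleKill`: **`RH ⟺ Re Q(φ'' − φ/4) ≥ 0` for every test `φ`** (no side
  condition: `(φ'' − φ/4)^(s) = s(s−1) φ̂(s)` kills both poles, `weilMellin_poleKill`).
* `riemannHypothesis_iff_prime_le_arch`: `RH ⟺ Re W_prime(g ⋆ g̃) ≤ Re W_arch(g ⋆ g̃)` on
  pole-free tests — "the primes are dominated by the archimedean place".
* `riemannHypothesis_iff_markovGap`: in the Markov decomposition
  `Re Q(g) = P(g) + 𝓔_a(g) − M_a ‖g‖₂²` (`WeilMarkovQuadratic.lean`: `𝓔_a` the pure-jump Dirichlet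
  form with jump rates `Λ(n) n^{-1/2}` at the lengths `log n < 2a` and archimedean density
  `e^{t/2}/(2 sinh t)`, `M_a` the killing constant), **`RH ⟺ 𝓔_a(g) ≥ M_a ‖g‖₂²` for every `a` and
  every pole-free test `g` supported in `[-a, a]`**: a spectral-gap inequality for a Markovian jump
  form on a codimension-two subspace of each window.

Why this is a reformulation and not an engine (recorded in the programme's census, F35): the one
structure `𝓔_a` has beyond bilinearity — normal contractions operate
(`weilDirichletEnergy_comp_le`) — does not preserve the pole-free subspace to which the criterion
restricts the form (`Φ ∘ g` is not orthogonal to `e^{±t/2}` when `g` is); and `M_a ~ 4 e^{a}`, so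
the gap has to be certified on windows whose killing rate is exponentially large.

References: E. Bombieri, *Remarks on Weil's quadratic functional in the theory of prime numbers I*,
Rend. Mat. Acc. Lincei (9) 11 (2000) 183–233, Thm. 1 (pp. 189–190) and Thm. 2 (p. 193);
H. Yoshida, *On Hermitian forms attached to zeta functions*, Adv. Stud. Pure Math. 21 (1992), §6.
-/

noncomputable section

open Complex Filter Set MeasureTheory
open scoped Real Topology ComplexConjugate ArithmeticFunction.vonMangoldt

namespace Summit.RiemannHypothesis.RiemannHypothesis.Theorems

open Literature.NumberTheory.LFunctions Literature.NumberTheory.LFunctions.WeilConverse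

/-! ## Bombieri's converse inside a dipole-stable class -/

/-- **Zeros on the line from positivity on a dipole-stable class.** If `P` is stable under the
dipoles `g ↦ g + c·g(· − x)`, `Re Q ≥ 0` on the tests in `P` (zero-side form `zeroForm`), and some
test in `P` has `P_g(ρ) ≠ 0`, then `Re ρ = 1/2`: `‖B_g(x)‖ ≤ Re Q(g)` for all real `x` by
polarisation inside the class, and a bounded generalised Dirichlet series has no term off the
imaginary axis. [cite: Bombieri2000Weil, Thm. 1 ("if" half, pp. 189–190)] -/
theorem re_eq_one_half_of_stable_class {P : (ℝ → ℂ) → Prop}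
    (hP : ∀ (g : ℝ → ℂ) (c : ℂ) (x : ℝ), IsWeilTest g → P g → P (translateMix g c x))
    (hQ : ∀ g : ℝ → ℂ, IsWeilTest g → P g → 0 ≤ (zeroForm g).re)
    {ρ : ℂ} (hρ : ρ ∈ ZetaZeros.riemannZetaNontrivialZeros)
    (hdet : ∃ g : ℝ → ℂ, IsWeilTest g ∧ P g ∧ pairCoeff g ρ ≠ 0) : ρ.re = 1 / 2 := by
  by_contra hre
  obtain ⟨g, hg, hPg, hne⟩ := hdet
  have hB : ∀ x : ℝ, ‖expSum g x‖ ≤ (zeroForm g).re := fun x ↦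
    combShapeDetection_norm_expSum_le_of_translateMix hg (hQ g hg hPg)
      fun c ↦ hQ _ (isWeilTest_translateMix hg c x) (hP g c x hg hPg)
  have h := combShapeDetection_order_mul_pairCoeff_eq_zero hg hB hρ hre
  have hm : (riemannZetaZeroOrder ρ : ℂ) ≠ 0 := by
    have := ZetaZeros.riemannZetaNontrivialZeros.one_le_order hρ
    exact_mod_cast (by omega : riemannZetaZeroOrder ρ ≠ 0)
  exact mul_ne_zero hm hne h

/-- **Bombieri's converse inside a dipole-stable, zero-detecting class**: positivity of
`Re Q(g) = Re W(g ⋆ g̃)` on the tests of a class `P` stable under `g ↦ g + c·g(· − x)` and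
containing, for every non-trivial zero `ρ`, a test with `P_g(ρ) ≠ 0`, implies the Riemann
hypothesis (`zeroForm = weilQuadratic` by the explicit formula). [cite: Bombieri2000Weil, Thm. 1] -/
theorem riemannHypothesis_of_stable_class {P : (ℝ → ℂ) → Prop}
    (hP : ∀ (g : ℝ → ℂ) (c : ℂ) (x : ℝ), IsWeilTest g → P g → P (translateMix g c x))
    (H : ∀ g : ℝ → ℂ, IsWeilTest g → P g → 0 ≤ (weilQuadratic g).re)
    (hdet : ∀ ρ ∈ ZetaZeros.riemannZetaNontrivialZeros,
      ∃ g : ℝ → ℂ, IsWeilTest g ∧ P g ∧ pairCoeff g ρ ≠ 0) :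
    RiemannHypothesis := by
  have hQ : ∀ g : ℝ → ℂ, IsWeilTest g → P g → 0 ≤ (zeroForm g).re := fun g hg hPg ↦ by
    rw [combShapeDetection_zeroForm_eq_weilQuadratic hg]
    exact H g hg hPg
  refine riemannHypothesis_iff_strip_holds.2 fun s hs h0 h1 ↦ ?_
  have hρ : s ∈ ZetaZeros.riemannZetaNontrivialZeros :=
    ZetaZeros.riemannZetaNontrivialZeros.mem_iff'.2 ⟨hs, h0, h1⟩
  exact re_eq_one_half_of_stable_class hP hQ hρ (hdet s hρ)

/-! ## The pole-free class `ĝ(0) = ĝ(1) = 0` and the pole killer `φ ↦ φ'' − φ/4` -/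

/-- The pole-free tests (`ĝ(0) = ĝ(1) = 0`) are stable under the dipoles `g + c·g(· − x)`
(`(g + c g_x)^(s) = ĝ(s)(1 + c e^{(s−1/2)x})`). [folklore] -/
theorem poleFree_translateMix {g : ℝ → ℂ} (hg : IsWeilTest g)
    (hp : weilMellin g 0 = 0 ∧ weilMellin g 1 = 0) (c : ℂ) (x : ℝ) :
    weilMellin (translateMix g c x) 0 = 0 ∧ weilMellin (translateMix g c x) 1 = 0 := by
  constructor
  · rw [weilMellin_translateMix hg, hp.1, zero_mul]
  · rw [weilMellin_translateMix hg, hp.2, zero_mul]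

/-- `φ'' − φ/4 = (d/dt − 1/2)(d/dt + 1/2) φ` is a test function. [folklore] -/
theorem isWeilTest_poleKill {φ : ℝ → ℂ} (hφ : IsWeilTest φ) :
    IsWeilTest (deriv (deriv φ) - fun t ↦ (4⁻¹ : ℂ) * φ t) :=
  hφ.deriv.deriv.sub (hφ.const_mul _)

/-- `(φ'' − φ/4)^(s) = ((s − 1/2)² − 1/4) φ̂(s) = s(s − 1) φ̂(s)`: the pole killer kills both
poles of the explicit formula. [folklore] -/
theorem weilMellin_poleKill {φ : ℝ → ℂ} (hφ : IsWeilTest φ) (s : ℂ) :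
    weilMellin (deriv (deriv φ) - fun t ↦ (4⁻¹ : ℂ) * φ t) s = s * (s - 1) * weilMellin φ s := by
  have hh : IsWeilTest fun t ↦ (4⁻¹ : ℂ) * φ t := hφ.const_mul _
  rw [weilMellin_sub hφ.deriv.deriv.1.continuous hφ.deriv.deriv.2 hh.1.continuous hh.2,
    weilMellin_const_mul, weilMellin_deriv_deriv hφ]
  ring

/-- `φ'' − φ/4` is pole-free. [folklore] -/
theorem poleFree_poleKill {φ : ℝ → ℂ} (hφ : IsWeilTest φ) :
    weilMellin (deriv (deriv φ) - fun t ↦ (4⁻¹ : ℂ) * φ t) 0 = 0 ∧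
      weilMellin (deriv (deriv φ) - fun t ↦ (4⁻¹ : ℂ) * φ t) 1 = 0 := by
  constructor <;> rw [weilMellin_poleKill hφ] <;> simp

/-- The pole killer commutes with the dipoles: `(φ + c φ_x)'' − (φ + c φ_x)/4 = g + c g_x`,
`g = φ'' − φ/4`. [folklore] -/
theorem translateMix_poleKill {φ : ℝ → ℂ} (hφ : IsWeilTest φ) (c : ℂ) (x : ℝ) :
    translateMix (deriv (deriv φ) - fun t ↦ (4⁻¹ : ℂ) * φ t) c x =
      deriv (deriv (translateMix φ c x)) - fun t ↦ (4⁻¹ : ℂ) * translateMix φ c x t := by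
  have h2 : deriv (deriv (translateMix φ c x)) = translateMix (deriv (deriv φ)) c x := by
    rw [deriv_translateMix hφ, deriv_translateMix hφ.deriv]
  rw [h2]
  funext t
  simp only [translateMix, weilTranslate, Pi.add_apply, Pi.sub_apply]
  ring

/-- `P_{φ'' − φ/4}(ρ) = (ρ(ρ − 1))² P_φ(ρ)` (the factor at `1 − ρ̄` is `(1 − ρ̄)(−ρ̄)`, whose
conjugate is again `ρ(ρ − 1)`). [folklore] -/
theorem pairCoeff_poleKill {φ : ℝ → ℂ} (hφ : IsWeilTest φ) (ρ : ℂ) :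
    pairCoeff (deriv (deriv φ) - fun t ↦ (4⁻¹ : ℂ) * φ t) ρ =
      (ρ * (ρ - 1)) ^ 2 * pairCoeff φ ρ := by
  rw [pairCoeff, pairCoeff, weilMellin_poleKill hφ, weilMellin_poleKill hφ]
  simp only [map_mul, map_sub, map_one, Complex.conj_conj]
  ring

/-- **Pole-free tests detect every non-trivial zero**: for `ρ` in the open strip there is a test
`φ` with `P_{φ'' − φ/4}(ρ) ≠ 0` (a narrow bump has `Re φ̂ > 0` on the horizontal line through `ρ`
and `1 − ρ̄`, `exists_isWeilTest_re_weilMellin_pos`, and `ρ ∉ {0, 1}`). [folklore] -/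
theorem exists_pairCoeff_poleKill_ne_zero {ρ : ℂ}
    (hρ : ρ ∈ ZetaZeros.riemannZetaNontrivialZeros) :
    ∃ φ : ℝ → ℂ, IsWeilTest φ ∧ pairCoeff (deriv (deriv φ) - fun t ↦ (4⁻¹ : ℂ) * φ t) ρ ≠ 0 := by
  obtain ⟨g, hg, hpos⟩ := exists_isWeilTest_re_weilMellin_pos ρ.im
  refine ⟨g, hg, ?_⟩
  have h0 := ZetaZeros.riemannZetaNontrivialZeros.re_pos hρ
  have h1' := ZetaZeros.riemannZetaNontrivialZeros.re_lt_one hρ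
  have hρ0 : ρ ≠ 0 := by
    intro h
    rw [h, Complex.zero_re] at h0
    exact lt_irrefl _ h0
  have hρ1 : ρ - 1 ≠ 0 := by
    intro h
    rw [sub_eq_zero.1 h, Complex.one_re] at h1'
    exact lt_irrefl _ h1'
  have h1 : weilMellin g ρ ≠ 0 := by
    intro h
    have := hpos ρ.re
    rw [show (ρ.re : ℂ) + ρ.im * I = ρ from Complex.re_add_im ρ, h, Complex.zero_re] at this
    exact lt_irrefl _ this
  have h2 : weilMellin g (1 - conj ρ) ≠ 0 := by
    intro h
    have := hpos (1 - ρ.re)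
    rw [show ((1 - ρ.re : ℝ) : ℂ) + ρ.im * I = 1 - conj ρ from ?_, h, Complex.zero_re] at this
    · exact lt_irrefl _ this
    · apply Complex.ext <;> simp
  rw [pairCoeff_poleKill hg, pairCoeff]
  exact mul_ne_zero (pow_ne_zero _ (mul_ne_zero hρ0 hρ1))
    (mul_ne_zero h1 ((map_ne_zero _).2 h2))

/-! ## The pole-free criteria -/

/-- **Weil's criterion, pole-free form**: `RH ⟺ Re W(g ⋆ g̃) ≥ 0` for every smooth compactly
supported `g` with `ĝ(0) = ĝ(1) = 0`. The class is dipole-stable (`poleFree_translateMix`) and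
detects every zero through `φ'' − φ/4` (`exists_pairCoeff_poleKill_ne_zero`).
[cite: Bombieri2000Weil, Thms. 1–2] -/
theorem riemannHypothesis_iff_poleFree :
    RiemannHypothesis ↔ ∀ g : ℝ → ℂ, IsWeilTest g →
      weilMellin g 0 = 0 → weilMellin g 1 = 0 → 0 ≤ (weilQuadratic g).re := by
  constructor
  · intro h g hg _ _
    exact weil_criterion_holds.1 h g hg
  · intro H
    refine riemannHypothesis_of_stable_class
      (P := fun g ↦ weilMellin g 0 = 0 ∧ weilMellin g 1 = 0)
      (fun g c x hg hp ↦ poleFree_translateMix hg hp c x) (fun g hg hp ↦ H g hg hp.1 hp.2)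
      fun ρ hρ ↦ ?_
    obtain ⟨φ, hφ, hne⟩ := exists_pairCoeff_poleKill_ne_zero hρ
    exact ⟨_, isWeilTest_poleKill hφ, poleFree_poleKill hφ, hne⟩

/-- **Weil's criterion without side condition on a pole-free range**:
`RH ⟺ Re W(g ⋆ g̃) ≥ 0` for `g = φ'' − φ/4`, `φ` ANY smooth compactly supported function.
[cite: Bombieri2000Weil, Thms. 1–2] -/
theorem riemannHypothesis_iff_poleKill :
    RiemannHypothesis ↔ ∀ φ : ℝ → ℂ, IsWeilTest φ →
      0 ≤ (weilQuadratic (deriv (deriv φ) - fun t ↦ (4⁻¹ : ℂ) * φ t)).re := by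
  constructor
  · intro h φ hφ
    exact weil_criterion_holds.1 h _ (isWeilTest_poleKill hφ)
  · intro H
    refine riemannHypothesis_of_stable_class
      (P := fun g ↦ ∃ φ : ℝ → ℂ, IsWeilTest φ ∧ g = deriv (deriv φ) - fun t ↦ (4⁻¹ : ℂ) * φ t)
      ?_ ?_ fun ρ hρ ↦ ?_
    · rintro _ c x - ⟨φ, hφ, rfl⟩
      exact ⟨translateMix φ c x, isWeilTest_translateMix hφ c x, translateMix_poleKill hφ c x⟩
    · rintro _ - ⟨φ, hφ, rfl⟩
      exact H φ hφ
    · obtain ⟨φ, hφ, hne⟩ := exists_pairCoeff_poleKill_ne_zero hρ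
      exact ⟨_, isWeilTest_poleKill hφ, ⟨φ, hφ, rfl⟩, hne⟩

/-! ## The explicit formula on pole-free tests: primes against the archimedean place -/

/-- On a pole-free test the polar term of `k = g ⋆ g̃` vanishes:
`k̂(0) + k̂(1) = 2 Re(ĝ(0) conj ĝ(1)) = 0`. [cite: Yoshida1992, §6 eq. (6.2)] -/
theorem weilPolarTerm_eq_zero_of_poleFree {g : ℝ → ℂ} (hg : IsWeilTest g)
    (h0 : weilMellin g 0 = 0) : weilPolarTerm (weilConv g (weilReflect g)) = 0 := by
  rw [weilPolarTerm_weilConv_weilReflect hg, h0, zero_mul, Complex.zero_re, mul_zero,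
    Complex.ofReal_zero]

/-- On a pole-free test the pole form vanishes: `P(g) = 0`. [cite: Yoshida1992, §6 eq. (6.2)] -/
theorem weilPoleForm_eq_zero_of_poleFree {g : ℝ → ℂ} (hg : IsWeilTest g)
    (h0 : weilMellin g 0 = 0) : weilPoleForm g = 0 := by
  rw [← two_mul_re_weilMellin_zero_mul_conj_one hg, h0, zero_mul, Complex.zero_re, mul_zero]

/-- On a pole-free test `Q(g) = −W_prime(g ⋆ g̃) + W_arch(g ⋆ g̃)`: no reference to the poles.
[cite: Bombieri2000Weil, Thm. 2 (p. 193)] -/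
theorem weilQuadratic_eq_of_poleFree {g : ℝ → ℂ} (hg : IsWeilTest g)
    (h0 : weilMellin g 0 = 0) :
    weilQuadratic g =
      -weilPrimeTerm (weilConv g (weilReflect g)) + weilArchTerm (weilConv g (weilReflect g)) := by
  rw [weilQuadratic, weilFunctional, weilPolarTerm_eq_zero_of_poleFree hg h0]
  ring

/-- **`RH ⟺` the primes are dominated by the archimedean place on pole-free tests**:
`RH ⟺ Re W_prime(g ⋆ g̃) ≤ Re W_arch(g ⋆ g̃)` for every test `g` with `ĝ(0) = ĝ(1) = 0`.
[cite: Bombieri2000Weil, Thms. 1–2] -/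
theorem riemannHypothesis_iff_prime_le_arch :
    RiemannHypothesis ↔ ∀ g : ℝ → ℂ, IsWeilTest g → weilMellin g 0 = 0 → weilMellin g 1 = 0 →
      (weilPrimeTerm (weilConv g (weilReflect g))).re ≤
        (weilArchTerm (weilConv g (weilReflect g))).re := by
  rw [riemannHypothesis_iff_poleFree]
  refine forall₄_congr fun g hg h0 _ ↦ ?_
  rw [weilQuadratic_eq_of_poleFree hg h0, Complex.add_re, Complex.neg_re]
  constructor <;> intro h <;> linarith

/-! ## The Markov spectral-gap form -/

/-- **`RH ⟺` spectral gap of the jump form on pole-free windows**: with `𝓔_a` the pure-jump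
Dirichlet form of the window `[-a, a]` (`weilDirichletEnergy`) and `M_a` its killing constant
(`weilMarkovConstant`), `RH ⟺ M_a ‖g‖₂² ≤ 𝓔_a(g)` for every `a` and every test `g` supported in
`[-a, a]` with `ĝ(0) = ĝ(1) = 0` (`Re Q(g) = P(g) + 𝓔_a(g) − M_a ‖g‖₂²`,
`weilQuadratic_re_eq_weilPoleForm_add_weilDirichletEnergy_sub`, and `P(g) = 0`).
[cite: Bombieri2000Weil, Thms. 1–2 (p. 193)] -/
theorem riemannHypothesis_iff_markovGap :
    RiemannHypothesis ↔ ∀ (a : ℝ) (g : ℝ → ℂ), IsWeilTest g → tsupport g ⊆ Icc (-a) a →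
      weilMellin g 0 = 0 → weilMellin g 1 = 0 →
        weilMarkovConstant a * (∫ x : ℝ, ‖g x‖ ^ 2) ≤ weilDirichletEnergy a g := by
  rw [riemannHypothesis_iff_poleFree]
  constructor
  · intro H a g hg hsupp h0 h1
    have h := H g hg h0 h1
    rw [weilQuadratic_re_eq_weilPoleForm_add_weilDirichletEnergy_sub hg hsupp,
      weilPoleForm_eq_zero_of_poleFree hg h0] at h
    linarith
  · intro H g hg h0 h1
    obtain ⟨b, -, hsupp⟩ := exists_tsupport_subset_Icc hg.2
    rw [weilQuadratic_re_eq_weilPoleForm_add_weilDirichletEnergy_sub hg hsupp,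
      weilPoleForm_eq_zero_of_poleFree hg h0]
    linarith [H b g hg hsupp h0 h1]

end Summit.RiemannHypothesis.RiemannHypothesis.Theorems

end
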